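import Summits.QuantumFields.YangMills.Theorems.LuscherReductionDressedRitzLiftLeakageClosingKinematic
import Summits.QuantumFields.YangMills.Theorems.FemtoTransferGapGroundState
import HarnessLib

/-!
# Crux `DressedRitz` (stmt-QuantumFields-20205), line «polyakovlift» r5, stub S-LEAK `stub_liftLeakage` — support XVII:
# the in-level Gram slot (GR) of S-LEAK IS the neighbour stub S-STAT — ★★★ S-LEAK ⟸ S-STAT + the (SLOW)(OUT)(CW) core

Support module (fleet seat ym-20205-polyakovlift-s1 gen 1; `--supports stmt-QuantumFields-20205`, helper, no closure claim).  The closing press-buttons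
for the registered stub `…Cruxes.DressedRitz.PolyakovLift.stub_liftLeakage` (XV `liftLeakage_dressed_of_slowOutsideLaw`, XVI `SlowOutsideLawAt`) carry an
in-level Gram hypothesis (GR) `|⟨v_n,v_{n'}⟩| ≤ γ‖v_n‖‖v_{n'}‖`, `Nγ ≤ 1/2`, for the dressed reference lifts inside one one-site level.  But the reference
family `(Ω₁, ψ_{i+1}/Ω₁)` of the tree (`LiftLeak.exists_reference_uniform`, p528897: the first one-site eigenfunctions at `B₁` over the positive vacuum)
IS a lift basis (`liftBasis_of_reference`), so the registered neighbour stub S-STAT (`Stmt.stub_liftStatics`: (o2) `|⟨u'_i,u'_l⟩| ≤ Cλ‖u'_i‖‖u'_l‖` for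
EVERY lift basis, dressed family) delivers (GR) with `γ = C_S·λ` — and `(N+1)γ ≤ 1/2` is a smallness condition on `lam0` only (`inLevelGram_of_staticClauses`).
Since the skeleton's composition `DressedRitz_of hS hU hB hK` holds `hS : Stmt.stub_liftStatics` anyway, the (GR) slot costs the line NOTHING:

* `liftBasis_of_reference` — `(Ω₁, (ψ_{i+1}/Ω₁)_{i<N})` is a `LiftBasis B N` when `ψ_0 … ψ_N` are the first exact one-site eigenfunctions (levels
  `levelValue j`) and `Ω₁` the positive raw vacuum;
* `inLevelGram_of_staticClauses` — S-STAT's (o2) for that basis ⇒ (GR) for every same-level pair of the reference family (`n = 0` never pairs: `μ₁ < μ₀`);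
* `SlowOutsideCoreAt k` — XVI's `SlowOutsideLawAt k` WITHOUT the Gram data (`γ`, `Nγ ≤ 1/2`, (GR)), reference levels pinned to `levelValue`, the
  separation index `N` quantified OUTSIDE the window (window-uniform, as V supplies it);
* ★★★ `liftLeakage_of_statics_and_core : Stmt-text(S-STAT) → (∀ k, SlowOutsideCoreAt k) → Stmt-text(S-LEAK)` (both texts VERBATIM r5).

So the located renormalisation-group debt of S-LEAK proper is (SLOW) + (OUT) + (CW) only; (GR) is S-STAT's (o2) (its own open core `GramUniversalityAt`,
infvol-p1).  Not proved here; no claim on either stub.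

HONEST FRAMING: quantifier plumbing at fixed lattice on the conditional femto rung R2b1; `stub_liftLeakage` and `stub_liftStatics` stay OPEN; nothing here
bears on infinite volume, the continuum limit or the Clay gap.
References: M. Lüscher, NPB 219 (1983) 233 [cite: Luscher1983, §3]; M. Lüscher, U. Wolff, NPB 339 (1990) 222 [cite: LuscherWolff1990, §2];
T. Kato, J. Phys. Soc. Japan 4 (1949) 334 [cite: Kato1949, §1]; M. Reed, B. Simon IV (1978) Thm XIII.1, XIII.43 [cite: ReedSimonIV1978].
-/

set_option autoImplicit false

noncomputable section

open MeasureTheory Filter Topology Finset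
open Literature.MathematicalPhysics.QuantumFieldTheory
open Literature.MathematicalPhysics.QuantumLattice
open scoped BigOperators

namespace Summit.QuantumFields.YangMills.Theorems.FemtoTransferGap.LiftLeak

open Summit.QuantumFields.YangMills.Theorems.FemtoTransferGap
open Summit.QuantumFields.YangMills.Theorems.FemtoTransferGap.PolyakovLift
open Summit.QuantumFields.YangMills.Theorems.FemtoTransferGap.VacDict

/-! ## §1 The reference family is a lift basis; S-STAT's (o2) is the (GR) slot -/

section Reference

/-- **The canonical reference family is a lift basis**: `Ω₁` the positive raw one-site vacuum at `B`, `ψ_0 … ψ_N` exact physical `l2`-orthonormal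
eigenfunctions with `K_Bψ_j = levelValue j · ψ_j`; then `(Ω₁, (ψ_{i+1}/Ω₁)_{i<N})` is a `LiftBasis B N` (labelling `σ = id`). [cite: ReedSimonIV1978, Thm XIII.1] -/
theorem liftBasis_of_reference {B : ℝ} {Ω₁ : GaugeConfig 3 1 SU2 → ℝ} (hΩ₁ : IsRawVacuum B Ω₁) (hpos : ∃ c : ℝ, 0 < c ∧ ∀ V, c ≤ Ω₁ V)
    {N : ℕ} {ψ : Fin (N + 1) → (GaugeConfig 3 1 SU2 → ℝ)} (hψ : ∀ n, IsPhys (ψ n))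
    (hon : ∀ n n', l2 (ψ n) (ψ n') = if n = n' then 1 else 0)
    (heig : ∀ n : Fin (N + 1), transferApply B (ψ n) = levelValue su2Rep 1 B n • ψ n) :
    LiftBasis B N Ω₁ (fun i => ψ i.succ / Ω₁) := by
  obtain ⟨c, hc, hcle⟩ := hpos
  have hne : ∀ V, Ω₁ V ≠ 0 := fun V => (hc.trans_le (hcle V)).ne'
  have hmul : ∀ i : Fin N, (ψ i.succ / Ω₁) * Ω₁ = ψ i.succ := fun i => by
    funext V; simp only [Pi.mul_apply, Pi.div_apply]; exact div_mul_cancel₀ _ (hne V)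
  refine ⟨hΩ₁.1, ⟨c, hc, hcle⟩, hΩ₁.2.1, hΩ₁.2.2, fun i => OpPlat.isPhys_div (hψ _) hΩ₁.1 hc hcle, ⟨Equiv.refl _, fun i => ?_⟩, fun i l => ?_⟩
  · rw [hmul, heig]
    simp only [Equiv.refl_apply, Fin.val_succ]
  · rw [hmul, hmul, hon]
    simp only [Fin.succ_inj]

variable {L : ℕ} [NeZero L]

/-- ★ **(GR) from S-STAT's (o2).**  With the reference data of `liftBasis_of_reference` at `B₁` and the `N` dressed reference lifts
`v_{i+1} = dressedLiftVec β Ω (ψ_{i+1}/Ω₁)` satisfying the time-0 clauses `StaticClauses N C_S β` (the registered S-STAT text instantiated at the lift basis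
`(Ω₁, ψ_{i+1}/Ω₁)`), every same-level pair `n ≠ n'` of `ψ_0 … ψ_N` obeys `|⟨v_n,v_{n'}⟩| ≤ (C_S·λ)·√‖v_n‖²·√‖v_{n'}‖²` (the vacuum index `0` never pairs:
`μ₁ < μ₀`). [cite: Luscher1983, §3] [cite: LuscherWolff1990, §2] -/
theorem inLevelGram_of_staticClauses (β : ℝ) (Ω : GaugeConfig 3 L SU2 → ℝ) {B : ℝ} (hB : 0 < B) {Ω₁ : GaugeConfig 3 1 SU2 → ℝ}
    {N : ℕ} {ψ : Fin (N + 1) → (GaugeConfig 3 1 SU2 → ℝ)} {C_S : ℝ}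
    (hstat : StaticClauses N C_S β (dressedLiftFamily β Ω (fun i => ψ i.succ / Ω₁))) :
    ∀ n n' : Fin (N + 1), n ≠ n' → levelValue su2Rep 1 B n = levelValue su2Rep 1 B n' →
      |l2 (dressedLiftVec β Ω (ψ n / Ω₁)) (dressedLiftVec β Ω (ψ n' / Ω₁))| ≤
        (C_S * luscherLambda β L) *
          (Real.sqrt (l2 (dressedLiftVec β Ω (ψ n / Ω₁)) (dressedLiftVec β Ω (ψ n / Ω₁))) *
            Real.sqrt (l2 (dressedLiftVec β Ω (ψ n' / Ω₁)) (dressedLiftVec β Ω (ψ n' / Ω₁)))) := by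
  -- levels `≥ 1` are strictly below level `0`
  have hlt : ∀ i : Fin N, levelValue su2Rep 1 B ((i.succ : Fin (N + 1)) : ℕ) < levelValue su2Rep 1 B ((0 : Fin (N + 1)) : ℕ) := fun i => by
    rw [Fin.val_succ, Fin.val_zero]
    exact (levelValue_le_of_le (L := 1) hB (Nat.succ_le_succ (Nat.zero_le _))).trans_lt (PhysL2.levelValue_one_lt_levelValue_zero (L := 1) B)
  intro n n' hne hev
  induction n using Fin.cases with
  | zero =>
    induction n' using Fin.cases with
    | zero => exact absurd rfl hne
    | succ i' => exact absurd hev (hlt i').ne'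
  | succ i =>
    induction n' using Fin.cases with
    | zero => exact absurd hev.symm (hlt i).ne'
    | succ i' =>
      have hii' : i ≠ i' := fun h => hne (by rw [h])
      exact hstat.2 i i' hii'

end Reference

/-! ## §2 The core without the Gram slot, and S-LEAK ⟸ S-STAT + core -/

/-- **`SlowOutsideCoreAt k`** — S-LEAK's renormalisation-group core WITHOUT the in-level Gram data: a window-uniform separation index `N`, constants
`C ≥ 0`, `lam0 > 0`; eventually in the window, at the Perron–Frobenius package: canonical reference one-site data `Ω₁`, `ψ_0 … ψ_N` (levels `levelValue j`
at `B₁ = liftCoupling β L`, domination `Λ₁ < μ_k(B₁)`), one exact fine eigenfamily (`χ`, `μ`, domination `Λ`), per reference lift an own index and a slow set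
with the kinematic side conditions and (SLOW) + (OUT) on the UNDRESSED `x_n = liftVec β Ω (ψ_n/Ω₁)`, the width condition (CW), and the rate
`4(N+1)((C₁+C₂)(λ³/L²)λ₀² + δ²) ≤ C(λ³/L²)λ₀²`. [cite: Luscher1983, §3] [cite: LuscherWolff1990, §2] -/
def SlowOutsideCoreAt (k : ℕ) : Prop :=
  ∃ (N : ℕ) (C lam0 : ℝ), 0 ≤ C ∧ 0 < lam0 ∧ ∀ lam : ℝ, 0 < lam → lam ≤ lam0 → ∃ L0 : ℕ,
    ∀ (L : ℕ) [NeZero L], L0 ≤ L → ∀ β : ℝ, InFemtoWindow lam β L →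
      ∀ (Ω : physSubmodule L) (θ c : ℝ), IsVacuum β Ω θ → 0 < c → (∀ U, c ≤ (Ω : GaugeConfig 3 L SU2 → ℝ) U) →
        ∃ (Ω₁ : GaugeConfig 3 1 SU2 → ℝ) (ψ : Fin (N + 1) → (GaugeConfig 3 1 SU2 → ℝ)) (Λ₁ : ℝ)
          (M : ℕ) (χ : Fin M → (GaugeConfig 3 L SU2 → ℝ)) (μ : Fin M → ℝ) (Λ : ℝ)
          (j₀ : Fin (N + 1) → Fin M) (S : Fin (N + 1) → Finset (Fin M)) (δ C₁ C₂ : ℝ),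
          IsRawVacuum (liftCoupling β L) Ω₁ ∧ (∃ c₁ : ℝ, 0 < c₁ ∧ ∀ V, c₁ ≤ Ω₁ V) ∧ (∀ n, IsPhys (ψ n)) ∧
          (∀ n n', l2 (ψ n) (ψ n') = if n = n' then 1 else 0) ∧
          (∀ n : Fin (N + 1), transferApply (liftCoupling β L) (ψ n) = levelValue su2Rep 1 (liftCoupling β L) n • ψ n) ∧
          0 ≤ Λ₁ ∧ Λ₁ < levelValue su2Rep 1 (liftCoupling β L) k ∧
          (∀ ξ : GaugeConfig 3 1 SU2 → ℝ, IsPhys ξ → (∀ n, l2 ξ (ψ n) = 0) →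
            l2 ξ (transferApply (liftCoupling β L) ξ) ≤ Λ₁ * l2 ξ ξ) ∧
          (∀ j, IsPhys (χ j)) ∧ (∀ j j', l2 (χ j) (χ j') = if j = j' then 1 else 0) ∧ (∀ j, transferApply β (χ j) = μ j • χ j) ∧ 0 ≤ Λ ∧
          (∀ ξ : GaugeConfig 3 L SU2 → ℝ, IsPhys ξ → (∀ j, l2 ξ (χ j) = 0) → l2 ξ (transferApply β ξ) ≤ Λ * l2 ξ ξ) ∧
          0 ≤ C₁ ∧ 0 ≤ C₂ ∧
          4 * (N + 1) * ((C₁ + C₂) * (luscherLambda β L ^ 3 / (L : ℝ) ^ 2) * levelValue su2Rep L β 0 ^ 2 + δ ^ 2) ≤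
            C * (luscherLambda β L ^ 3 / (L : ℝ) ^ 2) * levelValue su2Rep L β 0 ^ 2 ∧
          (∀ n, Λ ≤ μ (j₀ n) ∧ μ (j₀ n) ≤ levelValue su2Rep L β 0 ∧ (∀ j, j ∉ S n → μ j ≤ μ (j₀ n)) ∧
            ((dressSteps L : ℝ) + 1) ^ 2 * Λ ^ (2 * dressSteps L) ≤ μ (j₀ n) ^ (2 * dressSteps L) ∧
            ∑ j ∈ S n, (μ j - μ (j₀ n)) ^ 2 * μ j ^ (2 * dressSteps L) *
                l2 (liftVec β (Ω : GaugeConfig 3 L SU2 → ℝ) (ψ n / Ω₁)) (χ j) ^ 2 ≤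
              C₁ * (luscherLambda β L ^ 3 / (L : ℝ) ^ 2) * levelValue su2Rep L β 0 ^ 2 *
                (μ (j₀ n) ^ (2 * dressSteps L) * l2 (liftVec β (Ω : GaugeConfig 3 L SU2 → ℝ) (ψ n / Ω₁)) (χ (j₀ n)) ^ 2) ∧
            l2 (liftVec β (Ω : GaugeConfig 3 L SU2 → ℝ) (ψ n / Ω₁)) (liftVec β (Ω : GaugeConfig 3 L SU2 → ℝ) (ψ n / Ω₁)) -
                ∑ j ∈ S n, l2 (liftVec β (Ω : GaugeConfig 3 L SU2 → ℝ) (ψ n / Ω₁)) (χ j) ^ 2 ≤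
              C₂ * luscherLambda β L ^ 3 * l2 (liftVec β (Ω : GaugeConfig 3 L SU2 → ℝ) (ψ n / Ω₁)) (χ (j₀ n)) ^ 2) ∧
          (∀ n n' : Fin (N + 1), levelValue su2Rep 1 (liftCoupling β L) n = levelValue su2Rep 1 (liftCoupling β L) n' →
            (μ (j₀ n) - μ (j₀ n')) ^ 2 ≤ δ ^ 2)

/-- ★★★ **S-LEAK ⟸ S-STAT + `SlowOutsideCoreAt`**: the registered r5 text of `Stmt.stub_liftStatics` (first hypothesis, VERBATIM) and the core at every
level give the registered r5 text of `Stmt.stub_liftLeakage` (conclusion, VERBATIM).  (GR) comes from S-STAT's (o2) on the canonical reference lift basis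
with `γ = C_S·λ`, `lam0 ≤ 1/(4(N+1)(C_S+1))`; the rest is XIV → X → IX → VIII as in XV. [cite: Luscher1983, §3] [cite: LuscherWolff1990, §2] [cite: Kato1949, §1] -/
theorem liftLeakage_of_statics_and_core
    (hS : ∀ k : ℕ, ∃ C lam0 : ℝ, 0 ≤ C ∧ 0 < lam0 ∧ ∀ lam : ℝ, 0 < lam → lam ≤ lam0 → ∃ L0 : ℕ,
      ∀ (L : ℕ) [NeZero L], L0 ≤ L → ∀ β : ℝ, InFemtoWindow lam β L →
        ∀ φ : GaugeConfig 3 L SU2 → ℝ, IsRawVacuum β φ →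
          ∀ (ω : GaugeConfig 3 1 SU2 → ℝ) (g : Fin k → (GaugeConfig 3 1 SU2 → ℝ)), LiftBasis (liftCoupling β L) k ω g →
            StaticClauses k C β (dressedLiftFamily β φ g))
    (hcore : ∀ k : ℕ, SlowOutsideCoreAt k) :
    ∀ k : ℕ, ∃ C lam0 : ℝ, 0 ≤ C ∧ 0 < lam0 ∧ ∀ lam : ℝ, 0 < lam → lam ≤ lam0 → ∃ L0 : ℕ,
      ∀ (L : ℕ) [NeZero L], L0 ≤ L → ∀ β : ℝ, InFemtoWindow lam β L →
        ∀ φ : GaugeConfig 3 L SU2 → ℝ, IsRawVacuum β φ →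
          ∀ (ω : GaugeConfig 3 1 SU2 → ℝ) (g : Fin k → (GaugeConfig 3 1 SU2 → ℝ)), LiftBasis (liftCoupling β L) k ω g →
            LeakageClause k C β (dressedLiftFamily β φ g) := by
  intro k
  obtain ⟨N, C, lam0, hC, hlam0, hk⟩ := hcore k
  obtain ⟨C_S, lamS, hCS, hlamS, hkS⟩ := hS N
  set lam1 : ℝ := 1 / (4 * ((N : ℝ) + 1) * (C_S + 1)) with hlam1
  have hlam1pos : 0 < lam1 := by rw [hlam1]; positivity
  refine ⟨C, min lam0 (min lamS lam1), hC, lt_min hlam0 (lt_min hlamS hlam1pos), fun lam hlam hle => ?_⟩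
  have hle0 : lam ≤ lam0 := hle.trans (min_le_left _ _)
  have hleS : lam ≤ lamS := hle.trans ((min_le_right _ _).trans (min_le_left _ _))
  have hle1 : lam ≤ lam1 := hle.trans ((min_le_right _ _).trans (min_le_right _ _))
  obtain ⟨L0, hL⟩ := hk lam hlam hle0
  obtain ⟨L0S, hLS⟩ := hkS lam hlam hleS
  refine ⟨max L0 L0S, fun L _ hL0 β hW φ hφ ω g hb => ?_⟩
  obtain ⟨Ω, θ, c, hV, hc, hcle⟩ := exists_isVacuum (L := L) β
  obtain ⟨Ω₁, ψ, Λ₁, M, χ, μ, Λ, j₀, S, δ, C₁, C₂, hΩ₁, hpos, hψ, hon, heig, hΛ₁, hΛ₁k, hdom₁, hχ, honχ, heigχ, hΛ, hdomχ,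
    hC₁, hC₂, hrate, hper, hwidth⟩ := hL L ((le_max_left _ _).trans hL0) β hW Ω θ c hV hc hcle
  have hβ : 0 ≤ β := zero_le_one.trans hW.1
  have hlpos : 0 < luscherLambda β L := luscherLambda_pos_of_window hlam hW
  have hB : 0 < liftCoupling β L := by unfold liftCoupling; exact div_pos two_pos (pow_pos hlpos 3)
  have hΩphys : IsPhys (Ω : GaugeConfig 3 L SU2 → ℝ) := hV.raw.1
  have hΩraw : IsRawVacuum β (Ω : GaugeConfig 3 L SU2 → ℝ) := hV.raw
  obtain ⟨c₁, hc₁, hc₁le⟩ := hpos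
  have hG : ∀ n, IsPhys (ψ n / Ω₁) := fun n => OpPlat.isPhys_div (hψ n) hΩ₁.1 hc₁ hc₁le
  -- (GR) from S-STAT on the canonical reference lift basis
  have hbasis := liftBasis_of_reference hΩ₁ ⟨c₁, hc₁, hc₁le⟩ hψ hon heig
  have hstat := hLS L ((le_max_right _ _).trans hL0) β hW (Ω : GaugeConfig 3 L SU2 → ℝ) hΩraw Ω₁ (fun i => ψ i.succ / Ω₁) hbasis
  set γ : ℝ := C_S * luscherLambda β L with hγdef
  have hγ : 0 ≤ γ := mul_nonneg hCS hlpos.le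
  have hNγ : ((N + 1 : ℕ) : ℝ) * γ ≤ 1 / 2 := by
    have hl2 : luscherLambda β L ≤ 2 * lam := hW.2.2
    have hN1 : (0 : ℝ) < (N : ℝ) + 1 := by positivity
    push_cast
    calc ((N : ℝ) + 1) * (C_S * luscherLambda β L) ≤ ((N : ℝ) + 1) * (C_S * (2 * lam1)) := by
          apply mul_le_mul_of_nonneg_left _ hN1.le
          exact mul_le_mul_of_nonneg_left (hl2.trans (by linarith)) hCS
      _ = C_S / (C_S + 1) * (1 / 2) := by rw [hlam1]; field_simp; ring
      _ ≤ 1 * (1 / 2) := by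
          apply mul_le_mul_of_nonneg_right _ (by norm_num)
          rw [div_le_one (by linarith)]; linarith
      _ = 1 / 2 := one_mul _
  have hgram := inLevelGram_of_staticClauses β (Ω : GaugeConfig 3 L SU2 → ℝ) hB hstat
  -- (RL) per reference lift from (SLOW)+(OUT) (XIV), then all bases (X), then the clause (IX) and the raw vacuum (VIII)
  set ρ := (C₁ + C₂) * (luscherLambda β L ^ 3 / (L : ℝ) ^ 2) * levelValue su2Rep L β 0 ^ 2 with hρdef
  have hρ : 0 ≤ ρ := mul_nonneg (mul_nonneg (add_nonneg hC₁ hC₂) (div_nonneg (pow_nonneg hlpos.le 3) (sq_nonneg _))) (sq_nonneg _)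
  have hres : ∀ n, l2 (transferApply β (dressedLiftVec β (Ω : GaugeConfig 3 L SU2 → ℝ) (ψ n / Ω₁)) -
        μ (j₀ n) • dressedLiftVec β (Ω : GaugeConfig 3 L SU2 → ℝ) (ψ n / Ω₁))
      (transferApply β (dressedLiftVec β (Ω : GaugeConfig 3 L SU2 → ℝ) (ψ n / Ω₁)) -
        μ (j₀ n) • dressedLiftVec β (Ω : GaugeConfig 3 L SU2 → ℝ) (ψ n / Ω₁)) ≤
      ρ * l2 (dressedLiftVec β (Ω : GaugeConfig 3 L SU2 → ℝ) (ψ n / Ω₁)) (dressedLiftVec β (Ω : GaugeConfig 3 L SU2 → ℝ) (ψ n / Ω₁)) := by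
    intro n
    obtain ⟨hΛμ, hμtop, hSn, hgap, hslow, hout⟩ := hper n
    exact residual_dressedLiftVec_le_of_slow_outside hβ hΩphys (hG n) hχ honχ μ heigχ hΛ hdomχ (j₀ n) hΛμ hμtop (S n) hSn hgap hC₁ hC₂
      hslow hout
  have hres_all : ∀ i : Fin k, ∃ a' : ℝ,
      l2 (transferApply β (dressedLiftVec β (Ω : GaugeConfig 3 L SU2 → ℝ) (g i)) - a' • dressedLiftVec β (Ω : GaugeConfig 3 L SU2 → ℝ) (g i))
          (transferApply β (dressedLiftVec β (Ω : GaugeConfig 3 L SU2 → ℝ) (g i)) - a' • dressedLiftVec β (Ω : GaugeConfig 3 L SU2 → ℝ) (g i)) ≤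
        C * (luscherLambda β L ^ 3 / (L : ℝ) ^ 2) * levelValue su2Rep L β 0 ^ 2 *
          l2 (dressedLiftVec β (Ω : GaugeConfig 3 L SU2 → ℝ) (g i)) (dressedLiftVec β (Ω : GaugeConfig 3 L SU2 → ℝ) (g i)) := by
    intro i
    obtain ⟨a', ha'⟩ := residualLaw_allBases_of_reference_lift_width β (fun G => dressedLiftVec β (Ω : GaugeConfig 3 L SU2 → ℝ) G)
      (fun f c' hf => dressedLiftVec_sum_smul' β hΩphys f c' hf) (fun G hG' => isPhys_dressedLiftVec β hΩphys hG')
      hB k hΩ₁ ⟨c₁, hc₁, hc₁le⟩ hψ hon (fun n => levelValue su2Rep 1 (liftCoupling β L) n) heig hΛ₁ hΛ₁k hdom₁ (fun n => μ (j₀ n)) hρ hγ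
      hNγ hres hwidth hgram hb i
    have hrate' : 4 * ((N + 1 : ℕ) : ℝ) * (ρ + δ ^ 2) ≤ C * (luscherLambda β L ^ 3 / (L : ℝ) ^ 2) * levelValue su2Rep L β 0 ^ 2 := by
      push_cast; exact hrate
    exact ⟨a', ha'.trans (mul_le_mul_of_nonneg_right hrate' (l2_self_nonneg _))⟩
  have hΩclause : LeakageClause k C β (dressedLiftFamily β (Ω : GaugeConfig 3 L SU2 → ℝ) g) :=
    leakageClause_dressed_of_residual C β hΩphys hb.2.2.2.2.1 hres_all
  exact (leakageClause_iterate_iff hV hφ (dressSteps L) C g).2 hΩclause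

end Summit.QuantumFields.YangMills.Theorems.FemtoTransferGap.LiftLeak

end
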